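import Summits.QuantumFields.YangMills.Theorems.FemtoTransferGapRungW1upAlgebra
import Literature.MathematicalPhysics.QuantumLattice.SU2Haar
import Summits.QuantumFields.YangMills.Theorems.LuscherReductionOneSiteLevelsPhysClass
import Literature.MathematicalPhysics.QuantumFieldTheory.SU2HiggsKeyEstimate
import Literature.MathematicalPhysics.QuantumFieldTheory.Balaban1983to89.T4WilsonLinkAffine

/-!
# Chart-free pull-back of colour-rotation-invariant functions on `ℝ⁹` to PHYSICAL one-site test functions, via quaternion vector parts
# (support module for the registered stubs `stub_absLower` (AL2) and `stub_absUpper` (INNER: the constraint functions) of crux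
# `OneSiteLevels`, route `LuscherReduction`, item stmt-QuantumFields-20007; fleet lead prover ym-luscher-20007-p1)

Quasimodes of the one-site crux are pull-backs of eigenfunctions of Lüscher's `𝔥` on `ℝ⁹` (named fact `LuscherHamiltonianEigenfunctions`),
which are invariant under simultaneous colour rotations (`IsGaugeInv`: `ψ(R·x) = ψ(x)` for `R ∈ SO(3)`).  The usual pull-back goes through
the exponential chart; this module records the CHART-FREE alternative: write a link as a unit quaternion `su2Quat W = (u₀, u)` (tree
`SU2Haar`) and use the FOLDED VECTOR PART `foldVec W = sign(u₀)·u ∈ ℝ³` as the coordinate.  It is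

* twist-invariant: `foldVec (−W) = foldVec W` (`foldVec_negOne_mul`; the centre of `SU(2)` is `{±1}`), so NO sum over the 8 torons is needed;
* conjugation-EQUIVARIANT: `foldVec (g W g⁻¹) = ρ(g)·foldVec W` with `ρ(g) = qrotFun (su2Quat g)` the rotation of the tree's
  `TaoAveragedQuaternionRotation` (`foldVec_conj`; `su2Quat` is multiplicative, `su2Quat_mul`, and `su2Quat g⁻¹ = (su2Quat g)̄`, `su2Quat_inv`);
* equal to `u = sin(|c|/2)ĉ` near `+1` — i.e. to `c/2` up to `O(|c|³)` — so trial states built from `f(2·foldVec(U_i)/λ_b)` are as good as the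
  chart ones at the precision of the crux.
Consequently (`isPhys_foldVecFun`): for every bounded measurable `F : (Edge 3 1 → ℝ³) → ℝ` invariant under the simultaneous rotations
`ρ(g)` (`∀ g : SU2, F (fun e => qrotFun (su2Quat g) (v e)) = F v` — implied by `SO(3)`-invariance since `ρ(g) ∈ SO(3)`), the one-site test
function `U ↦ F (fun e => foldVec (U e))` is PHYSICAL (`IsPhys`).

## WHAT THIS IS NOT
No analysis; the identification `ρ(g) ∈ SO(3)` as a `Matrix.specialOrthogonalGroup` element (to plug `IsGaugeInv` literally) is left to the
user module (the tree has `det_qrot = 1` and `inner_qrotFun`); NOT the crux, NOT THE CLAY GAP.  Sorry-free; no named fact.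
-/

set_option autoImplicit false

noncomputable section

open MeasureTheory Filter Topology Real Quaternion
open scoped Matrix ComplexConjugate BigOperators Quaternion
open Literature.MathematicalPhysics.QuantumFieldTheory
open Literature.MathematicalPhysics.QuantumLattice
open Literature.Analysis.FluidPDE.Tao2016
open Literature.MathematicalPhysics.QuantumFieldTheory.Balaban1983to89.T4WilsonLinkAffine (su2Quat_inv)

namespace Summit.QuantumFields.YangMills.Theorems.FemtoTransferGap

/-! ### §1. `su2Quat` is a multiplicative, star-preserving embedding (tree: `quatMatrix_injective`, `su2Quat_mul`, `su2Quat_inv`) -/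

/-- `su2Quat 1 = 1`. [folklore] -/
theorem su2Quat_one : su2Quat (1 : SU2) = 1 := by
  apply quatMatrix_injective
  rw [quatMatrix_su2Quat, quatMatrix_one, OneMemClass.coe_one]

/-- `su2Quat negOne = −1`. [folklore] -/
theorem su2Quat_negOne : su2Quat negOne = -1 := by
  apply quatMatrix_injective
  rw [quatMatrix_su2Quat, quatMatrix_neg, quatMatrix_one]
  rfl

/-! ### §2. The folded vector part -/

/-- **Folded vector part** of a link: `sign(u₀)·u` for `su2Quat W = (u₀, u)` — the vector part reflected so that `W` and `−W` get the same
coordinate (zero on the equator `u₀ = 0`, far from both centre elements). [folklore] -/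
def foldVec (W : SU2) : EuclideanSpace ℝ (Fin 3) := Real.sign (su2Quat W).re • vecOf (su2Quat W)

/-- `vecOf` is odd. [folklore] -/
theorem vecOf_neg (q : ℍ) : vecOf (-q) = -vecOf q := by
  ext i; fin_cases i <;> simp [vecOf]

/-- **Twist invariance**: `foldVec (−W) = foldVec W`. [cite: tHooft1979] -/
theorem foldVec_negOne_mul (W : SU2) : foldVec (negOne * W) = foldVec W := by
  unfold foldVec
  rw [su2Quat_mul, su2Quat_negOne, neg_one_mul, vecOf_neg, Quaternion.re_neg, Real.sign_neg, neg_smul, smul_neg, neg_neg]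

/-- Twist invariance for any central element. [cite: tHooft1979] -/
theorem foldVec_center_mul {z : SU2} (hz : z ∈ Subgroup.center SU2) (W : SU2) : foldVec (z * W) = foldVec W := by
  rcases eq_one_or_eq_negOne_of_mem_center hz with rfl | rfl
  · rw [one_mul]
  · exact foldVec_negOne_mul W

/-- The scalar part is a class function: `re (q p q̄) = re p` for a unit `q`. [folklore] -/
theorem re_conj_su2Quat (g W : SU2) : (su2Quat (g * W * g⁻¹)).re = (su2Quat W).re := by
  rw [su2Quat_mul, su2Quat_mul, su2Quat_inv]
  have hn : normSq (su2Quat g) = 1 := normSq_su2Quat g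
  set q := su2Quat g
  set p := su2Quat W
  -- `re (q p q̄) = |q|² re p`
  have : (q * p * star q).re = normSq q * p.re := by
    simp only [Quaternion.re_mul, Quaternion.imI_mul, Quaternion.imJ_mul, Quaternion.imK_mul, Quaternion.re_star,
      Quaternion.imI_star, Quaternion.imJ_star, Quaternion.imK_star, Quaternion.normSq_def']
    ring
  rw [this, hn, one_mul]

/-- The vector part is conjugation-equivariant: `vecOf (q p q̄) = ρ(q)·vecOf p` for a unit `q`. [folklore] -/
theorem vecOf_conj_su2Quat (g W : SU2) : vecOf (su2Quat (g * W * g⁻¹)) = qrotFun (su2Quat g) (vecOf (su2Quat W)) := by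
  rw [su2Quat_mul, su2Quat_mul, su2Quat_inv]
  have hn : normSq (su2Quat g) = 1 := normSq_su2Quat g
  set q := su2Quat g
  set p := su2Quat W
  unfold qrotFun
  rw [hn, inv_one, one_smul]
  ext i
  fin_cases i <;>
    simp [vecOf, quatOf, Quaternion.imI_mul, Quaternion.imJ_mul, Quaternion.imK_mul, Quaternion.re_mul] <;> ring

/-- **Conjugation equivariance of the folded vector part**: `foldVec (g W g⁻¹) = ρ(g)·foldVec W`. [folklore] -/
theorem foldVec_conj (g W : SU2) : foldVec (g * W * g⁻¹) = qrotFun (su2Quat g) (foldVec W) := by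
  unfold foldVec
  rw [re_conj_su2Quat, vecOf_conj_su2Quat, qrotFun_smul]

/-- The real coordinates of a link's quaternion are continuous. [folklore] -/
theorem continuous_su2Quat_re : Continuous fun W : SU2 => (su2Quat W).re :=
  Complex.continuous_re.comp ((continuous_apply_apply 0 0).comp continuous_subtype_val)

/-- Coordinates of the folded vector part: `foldVec W a = sign(u₀) · u_a`. [folklore] -/
theorem foldVec_apply (W : SU2) (a : Fin 3) : foldVec W a = Real.sign (su2Quat W).re * vecOf (su2Quat W) a := by
  unfold foldVec
  rfl

/-- The coordinates of the vector part of a link's quaternion, as matrix entries. [folklore] -/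
theorem vecOf_su2Quat_apply (W : SU2) (a : Fin 3) :
    vecOf (su2Quat W) a = ![((W : Matrix (Fin 2) (Fin 2) ℂ) 0 0).im, ((W : Matrix (Fin 2) (Fin 2) ℂ) 0 1).re,
      ((W : Matrix (Fin 2) (Fin 2) ℂ) 0 1).im] a := by
  fin_cases a <;> simp [vecOf, su2Quat]

/-- Each coordinate of the vector part is continuous on `SU(2)`. [folklore] -/
theorem continuous_vecOf_su2Quat_apply (a : Fin 3) : Continuous fun W : SU2 => vecOf (su2Quat W) a := by
  have h00 : Continuous fun W : SU2 => (W : Matrix (Fin 2) (Fin 2) ℂ) 0 0 :=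
    (continuous_apply_apply 0 0).comp continuous_subtype_val
  have h01 : Continuous fun W : SU2 => (W : Matrix (Fin 2) (Fin 2) ℂ) 0 1 :=
    (continuous_apply_apply 0 1).comp continuous_subtype_val
  simp_rw [vecOf_su2Quat_apply]
  have hall : Continuous fun W : SU2 => ![((W : Matrix (Fin 2) (Fin 2) ℂ) 0 0).im, ((W : Matrix (Fin 2) (Fin 2) ℂ) 0 1).re,
      ((W : Matrix (Fin 2) (Fin 2) ℂ) 0 1).im] := by
    refine continuous_pi fun i => ?_
    fin_cases i
    · exact Complex.continuous_im.comp h00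
    · exact Complex.continuous_re.comp h01
    · exact Complex.continuous_im.comp h01
  exact (continuous_apply a).comp hall

/-- Each coordinate of the folded vector part is measurable. [folklore] -/
theorem measurable_foldVec_apply (a : Fin 3) : Measurable fun W : SU2 => foldVec W a := by
  haveI := secondCountableTopology_su2
  simp_rw [foldVec_apply]
  have hsign : Measurable Real.sign := by
    have : Real.sign = fun r : ℝ => if r < 0 then (-1 : ℝ) else if 0 < r then 1 else 0 := by
      funext r; rfl
    rw [this]
    exact Measurable.ite measurableSet_Iio measurable_const
      (Measurable.ite measurableSet_Ioi measurable_const measurable_const)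
  exact (hsign.comp continuous_su2Quat_re.measurable).mul (continuous_vecOf_su2Quat_apply a).measurable

/-! ### §3. Pull-backs of rotation-invariant functions of the folded vector parts are physical -/

/-- **Chart-free physical pull-back.**  Let `F : (Edge 3 1 → Fin 3 → ℝ) → ℝ` be bounded, measurable, and invariant under the simultaneous
rotations `ρ(g)`, `g ∈ SU(2)` (which is what `SO(3)`-colour-rotation invariance of a function on `ℝ⁹ = (ℝ³)³` provides, `ρ(g) ∈ SO(3)`).
Then the one-site test function `U ↦ F((foldVec (U e))_e)` is PHYSICAL: measurable, bounded, gauge invariant (conjugation acts on folded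
vector parts by `ρ(g)`) and zero-flux (twists act trivially on folded vector parts). [cite: Luscher1983, §2] [cite: tHooft1979] -/
theorem isPhys_foldVecFun (F : (Edge 3 1 → Fin 3 → ℝ) → ℝ) (hFm : Measurable F) {C : ℝ} (hC : ∀ v, |F v| ≤ C)
    (hFrot : ∀ (g : SU2) (v : Edge 3 1 → EuclideanSpace ℝ (Fin 3)),
      F (fun e a => qrotFun (su2Quat g) (v e) a) = F (fun e a => v e a)) :
    IsPhys (fun U : GaugeConfig 3 1 SU2 => F (fun e a => foldVec (U e) a)) where
  measurable := hFm.comp (measurable_pi_lambda _ fun e => measurable_pi_lambda _ fun a =>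
    (measurable_foldVec_apply a).comp (measurable_pi_apply e))
  bounded := ⟨C, fun U => hC _⟩
  gaugeInv := fun g U => by
    have hg : ∀ e : Edge 3 1, gaugeTransform g U e = g default * U e * (g default)⁻¹ := fun e => by
      rw [gaugeTransform_one_site, Subsingleton.elim e.1 default]
    have h1 : (fun e a => foldVec (gaugeTransform g U e) a) = fun e a => qrotFun (su2Quat (g default)) (foldVec (U e)) a := by
      funext e a
      rw [hg e, foldVec_conj]
    simp only []
    rw [h1, hFrot]
  zeroFlux := fun k z hz U => by
    have h1 : (fun e a => foldVec (twist k z U e) a) = fun e a => foldVec (U e) a := by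
      funext e a
      rcases twist_apply_eq_or k z U e with h | h
      · rw [h, foldVec_center_mul hz]
      · rw [h]
    simp only []
    rw [h1]

end Summit.QuantumFields.YangMills.Theorems.FemtoTransferGap

end
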